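import Summits.QuantumFields.BalabanUV.Beta.SymSecondOrderClassStep
import Summits.QuantumFields.BalabanUV.Beta.CombSecondOrderRemainderAn1

/-!
# `BalabanUV.Beta.CombSecondOrderClassStep` — binder row D1, RULING R-D1-g35-1 (chart (III′)), programme P6 (localisation tail): **THE (III′) TWIN OF `SymSecondOrderClassStep`** — the same
# localisation∕class bookkeeping for the chart-(III′) remainder tables `combR2An1`∕`combΔAn1` (`CombSecondOrderRemainderAn1`) at the comb-chart resolvents `GcombSh Lc j`;
# ONLY the literal instances are twinned (`Gsym ↦ GcombSh`, `decays_Gsym ↦ decays_GcombSh`, `symR2An1`∕`symΔAn1` ↦ `combR2An1`∕`combΔAn1`): the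
# resolvent-generic §1 (separation combinators) and §2 (`locStencil₂_R2succ_of_sep`) of `SymSecondOrderClassStep`, `pkg_of_spr`, and the generic
# generator∕product-symbol classes of `SymSecondOrderSplitLoc` §1∕§5 are IMPORTED AND REUSED BY NAME, not restated.
# * §3 `locStencil₂_R2succ_symTablesAn1` — the class step of the `hR2succ` right-hand side at the chart-(III′) literal `(GcombSh Lc j, bhKStepSh 3 Lc (Dsh Lc) j)`.
# * §4 `locStencil₂_combR2An1_succ` — the class of `combR2An1 … (j+1) α` from the level-`j` separation classes (through `hR2succ_comb`, `rfl`).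

HONEST FRAMING (cell contract, verbatim): «discharging `BetaPertH` makes Bałaban's UV stability UNCONDITIONAL — a real constructive-QFT
result; it is NOT the continuum limit and NOT the Clay problem.»  HONEST DEPENDENCY: continuum YM on T⁴ ⇐ BetaPertH ∧ nine spine estimates (0/9 proved);
BetaPertH ⇐ (D1) ∧ (D4) ∧ CAP+tail; G-an2-4 gates asym, D1 and NE2/3/4.  DERIVED cell leaf ([folklore] BY NAME; β sub-cell, row-D1 OWNER `b2b-balaban-beta-an2` gen 36;
chart (II) original by the D1 formalisation swarm leaf-03∕leaf-10 and the owner).  No statement of Bałaban's papers, no `[cite:]`, no `Prop` fact, no `def`.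
RECORD = ROOT M′ p303989 (chart (II)) unchanged; NOT D1, NOT `BetaPertH`, NOT continuum, NOT Clay.
Provenance: β sub-cell, unit beta-an2 gen 36 (v1 draft, text-transformed) ∕ gen 37 (v2: generic lemmas imported, 2026-08-22); no existing file touched.
-/

noncomputable section

open Finset
open scoped BigOperators
open Literature.MathematicalPhysics.QuantumFieldTheory
open Literature.MathematicalPhysics.QuantumFieldTheory.Balaban1983to89
open Literature.MathematicalPhysics.QuantumFieldTheory.Balaban1983to89.Beta
open B12Sec2to5 (l1 l1_nonneg)
open ExpKernelCalculus (MKer Site Decays BiLoc VertexFamily comp Zl Zl_nonneg l1_sub_symm biLoc_comp_decays)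
open KernelWard (biLoc_add biLoc_sub)
open AveragingContoursRooted (ctr ctrOff ctrOff_mem_box)
open OneStepResolventKernel (Fib LocStencil decays_mono biLoc_mono)
open OneStepKernelFamily (colH vertexOfK)
open BalabanStepJetsSucc (mmRead biLoc_comp_right l1_sub_le_l1_smul_sub wVH)
open BalabanStepW2 (biLoc_le_mono wV4)
open BalabanCompositeJets (LocStencil₂)
open SecondOrderResponse (dM biLoc_neg)
open Summit.QuantumFields.BalabanUV.Beta.TameKernelCalculus
open Summit.QuantumFields.BalabanUV.Beta.ChartConjugation (conjV)
open Summit.QuantumFields.BalabanUV.Beta.ChartConjugationDefectEnd (sandwichDefect)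
open Summit.QuantumFields.BalabanUV.Beta.AxialDressingRooted (one_le_of_neZero)
open Summit.QuantumFields.BalabanUV.Beta.BorderedHessian (bhK diagK spr_bhK)
open Summit.QuantumFields.BalabanUV.Beta.WardLocusCubic (mmSym)
open Summit.QuantumFields.BalabanUV.Beta.SecondOrderSeparationCalculus (sep_of_le sep_add sep_neg sep_swap sep_symRem)
open Summit.QuantumFields.BalabanUV.Beta.SecondOrderStepRemainder (locStencil₂_mmRead locStencil₂_stepRemainder)
open Summit.QuantumFields.BalabanUV.Beta.SecondOrderClassStep (locStencil₂_diagK_mmSym_of_sep)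
open Summit.QuantumFields.BalabanUV.Beta.SecondOrderDefectWordsSep (sep_defectWords)
open Summit.QuantumFields.BalabanUV.Beta.CombChartStepJets (GcombSh decays_GcombSh)
open Summit.QuantumFields.BalabanUV.Beta.DshAn1 (Dsh)
open Summit.QuantumFields.BalabanUV.Beta.SpineRooted (M1Of SpureRecOf locStencil_SpureRecOf vertexFamily_M1Of)
open Summit.QuantumFields.BalabanUV.Beta.SymShiftedSpread (bhKStepSh spr_bhKStepSh)
open Summit.QuantumFields.BalabanUV.Beta.RelInvNullShift (spr_add)
open Summit.QuantumFields.BalabanUV.Beta.DshAn1 (Dsh spr_Dsh)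
open Summit.QuantumFields.BalabanUV.Beta.E3ContactGenerator (ctGenM)
open Summit.QuantumFields.BalabanUV.Beta.SymAveragingHessianCounts (symVhSAt symHessFFAt symVhSAt_hV_ctr symHessFFAt_hH_ctr)
open Summit.QuantumFields.BalabanUV.Beta.SymSecondOrderSplitLoc (locStencil_diagK_mul_ctGenM locStencil₂_diagK_ctGenM_mul_ctGenM)
open Summit.QuantumFields.BalabanUV.Beta.SymSecondOrderClassStep (locStencil₂_R2succ_of_sep pkg_of_spr)
open Summit.QuantumFields.BalabanUV.Beta.CombSecondOrderRemainderAn1 (combR2An1 combΔAn1 hR2succ_comb)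

namespace Summit.QuantumFields.BalabanUV.Beta.CombSecondOrderClassStep

variable {d N : ℕ}

/-! ## §3 The class step at the (0.4) literal: ROOT J's `hR2succ` right-hand side, verbatim -/

section Literal

variable {Lc : ℕ} [NeZero Lc]

/-- [folklore] **THE CLASS STEP OF ROOT J's `hR2succ` AT THE (0.4) LITERAL.**  For every level `j`, axis `α`, every `γ`, `cΛ`, and free tables
`X2s`, `Δ` (ROOT J's binders, indexed by `(j, α)`): if `diagK ∘ X2s j α` and `Δ j α` are separation-localised at level `j`, then the right-hand side
of `hR2succ` — with `G_j = GcombSh Lc j`, `𝕄_j = bhKStepSh 3 Lc (Dsh Lc) j`, an1's recursive pure stencils and multiplier tables, the dressed generator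
`γ_j·E`, the product symbol `(γ_{j+1}·E_{κu})·(γ_{j+1}·E_{κ′u′})` and border remainder `0`, TOKEN FOR TOKEN as ROOT J displays it (tree l.128–150) —
is a `LocStencil₂` family at some positive rate: the class of `R2 (j+1) α` once ROOT K defines `R2` by this recursion.  Uses (DG) `decays_GcombSh`,
(Dspr) `spr_Dsh`, `spr_bhKStepSh`, `spr_bhK`, `locStencil_SpureRecOf` over (LV)(LH), `vertexFamily_M1Of`, and `SymSecondOrderSplitLoc` §1 ∕ §5 for
the generator and the product symbol; no `Odd Lc`, no lock, no letter. -/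
theorem locStencil₂_R2succ_symTablesAn1 (cΛ : ℝ) (γ : ℕ → ℝ) (j : ℕ) (α : Fin 4)
    {X2s : ℕ → Fin 4 → Fin 4 → (Fin 4 → ℤ) → Fin 4 → (Fin 4 → ℤ) → (Fin 4 → ℤ) → Fib 3 → ℝ}
    {Δ : ℕ → Fin 4 → Fin 4 → (Fin 4 → ℤ) → Fin 4 → (Fin 4 → ℤ) → MKer 4 (Fib 3)}
    (hX : ∃ C δ : ℝ, 0 < δ ∧ ∀ μ y ν y', BiLoc (diagK (X2s j α μ y ν y')) ((Lc : ℤ) • y) ((Lc : ℤ) • y)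
      (C * Real.exp (-δ * l1 ((Lc : ℤ) • y - (Lc : ℤ) • y'))) δ)
    (hΔ : ∃ C δ : ℝ, 0 < δ ∧ ∀ μ y ν y', BiLoc (Δ j α μ y ν y') ((Lc : ℤ) • y) ((Lc : ℤ) • y)
      (C * Real.exp (-δ * l1 ((Lc : ℤ) • y - (Lc : ℤ) • y'))) δ) :
    ∃ C δ : ℝ, 0 < δ ∧ LocStencil₂ (fun (κ : Fin 4) (u : Fin 4 → ℤ) (κ' : Fin 4) (u' : Fin 4 → ℤ) =>
          (-((((Lc : ℝ) ^ 8) * wV4 3 Lc (j + 1)) • mmRead Lc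
              (comp (comp (GcombSh Lc j) (((1 / 2 : ℝ) • conjV (bhKStepSh 3 Lc (Dsh Lc) j) (diagK fun p a => X2s j α κ' u' κ u p a - X2s j α κ u κ' u' p a) +
                (1 / 2 : ℝ) • (Δ j α κ u κ' u' + Δ j α κ' u' κ u)))) (GcombSh Lc j) -
                (comp (sandwichDefect (GcombSh Lc j) (bhKStepSh 3 Lc (Dsh Lc) j)
                      (diagK fun p c => ∑ ι, ∑' v, colH (GcombSh Lc j) Lc κ u ι v * (γ j * ctGenM 3 (bhK Lc + Dsh Lc) α Lc ι v p c)))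
                    (comp (dM (GcombSh Lc j) Lc (SpureRecOf 3 Lc (symVhSAt (ctr 4 Lc) 3 Lc rfl) (symHessFFAt (ctr 4 Lc) Lc) (GcombSh Lc) ((Lc : ℝ) ^ 4) (-((Lc : ℝ) ^ 8 / 2)) cΛ j) (M1Of 3 Lc (symHessFFAt (ctr 4 Lc) Lc) cΛ j) κ' u') (GcombSh Lc j) -
                      diagK fun p c => ∑ ι, ∑' v, colH (GcombSh Lc j) Lc κ' u' ι v * (γ j * ctGenM 3 (bhK Lc + Dsh Lc) α Lc ι v p c))
                  + comp (comp (GcombSh Lc j) (dM (GcombSh Lc j) Lc (SpureRecOf 3 Lc (symVhSAt (ctr 4 Lc) 3 Lc rfl) (symHessFFAt (ctr 4 Lc) Lc) (GcombSh Lc) ((Lc : ℝ) ^ 4) (-((Lc : ℝ) ^ 8 / 2)) cΛ j) (M1Of 3 Lc (symHessFFAt (ctr 4 Lc) Lc) cΛ j) κ u +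
                      conjV (bhKStepSh 3 Lc (Dsh Lc) j) (diagK fun p c => ∑ ι, ∑' v, colH (GcombSh Lc j) Lc κ u ι v * (γ j * ctGenM 3 (bhK Lc + Dsh Lc) α Lc ι v p c))))
                    (sandwichDefect (GcombSh Lc j) (bhKStepSh 3 Lc (Dsh Lc) j)
                      (diagK fun p c => ∑ ι, ∑' v, colH (GcombSh Lc j) Lc κ' u' ι v * (γ j * ctGenM 3 (bhK Lc + Dsh Lc) α Lc ι v p c)))
                  + comp (sandwichDefect (GcombSh Lc j) (bhKStepSh 3 Lc (Dsh Lc) j)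
                      (diagK fun p c => ∑ ι, ∑' v, colH (GcombSh Lc j) Lc κ' u' ι v * (γ j * ctGenM 3 (bhK Lc + Dsh Lc) α Lc ι v p c)))
                    (comp (dM (GcombSh Lc j) Lc (SpureRecOf 3 Lc (symVhSAt (ctr 4 Lc) 3 Lc rfl) (symHessFFAt (ctr 4 Lc) Lc) (GcombSh Lc) ((Lc : ℝ) ^ 4) (-((Lc : ℝ) ^ 8 / 2)) cΛ j) (M1Of 3 Lc (symHessFFAt (ctr 4 Lc) Lc) cΛ j) κ u) (GcombSh Lc j) -
                      diagK fun p c => ∑ ι, ∑' v, colH (GcombSh Lc j) Lc κ u ι v * (γ j * ctGenM 3 (bhK Lc + Dsh Lc) α Lc ι v p c))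
                  + comp (comp (GcombSh Lc j) (dM (GcombSh Lc j) Lc (SpureRecOf 3 Lc (symVhSAt (ctr 4 Lc) 3 Lc rfl) (symHessFFAt (ctr 4 Lc) Lc) (GcombSh Lc) ((Lc : ℝ) ^ 4) (-((Lc : ℝ) ^ 8 / 2)) cΛ j) (M1Of 3 Lc (symHessFFAt (ctr 4 Lc) Lc) cΛ j) κ' u' +
                      conjV (bhKStepSh 3 Lc (Dsh Lc) j) (diagK fun p c => ∑ ι, ∑' v, colH (GcombSh Lc j) Lc κ' u' ι v * (γ j * ctGenM 3 (bhK Lc + Dsh Lc) α Lc ι v p c))))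
                    (sandwichDefect (GcombSh Lc j) (bhKStepSh 3 Lc (Dsh Lc) j)
                      (diagK fun p c => ∑ ι, ∑' v, colH (GcombSh Lc j) Lc κ u ι v * (γ j * ctGenM 3 (bhK Lc + Dsh Lc) α Lc ι v p c)))))) +
            (0 : ℕ → Fin 4 → Fin 4 → (Fin 4 → ℤ) → Fin 4 → (Fin 4 → ℤ) → MKer 4 (Fib 3)) (j + 1) α κ u κ' u' +
            conjV (mmRead Lc (GcombSh (d := 3) Lc j))
              (diagK fun p c => ((Lc : ℝ) ^ 8) * wV4 3 Lc (j + 1) * mmSym Lc (X2s j α κ u κ' u') p c - wVH 3 Lc (j + 1) * ((γ (j + 1) * ctGenM 3 (bhK Lc + Dsh Lc) α Lc κ u p c) * (γ (j + 1) * ctGenM 3 (bhK Lc + Dsh Lc) α Lc κ' u' p c))))) C δ := by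
  have hL1 : 1 ≤ Lc := one_le_of_neZero Lc
  have hG : ∃ δ C : ℝ, 0 < δ ∧ 0 ≤ C ∧ Decays (GcombSh (d := 3) Lc j) C δ := decays_GcombSh Lc j
  have h𝕄 : ∃ δ C : ℝ, 0 < δ ∧ 0 ≤ C ∧ Decays (bhKStepSh 3 Lc (Dsh Lc) j) C δ := pkg_of_spr (spr_bhKStepSh (spr_Dsh hL1) j)
  obtain ⟨δB, CB, hδB, hCB, hBd⟩ := pkg_of_spr (spr_add (spr_bhK (d := 3) hL1) (spr_Dsh hL1))
  obtain ⟨C1, hH1⟩ := symHessFFAt_hH_ctr (d := 3) hL1 1 zero_le_one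
  have hS := locStencil_SpureRecOf (d := 3) hL1 (symVhSAt_hV_ctr (d := 3) hL1) (symHessFFAt_hH_ctr (d := 3) hL1) (decays_GcombSh Lc)
    ((Lc : ℝ) ^ 4) (-((Lc : ℝ) ^ 8 / 2)) cΛ j
  have hM : ∃ CM δM : ℝ, 0 < δM ∧ VertexFamily (M1Of 3 Lc (symHessFFAt (ctr 4 Lc) Lc) cΛ j) Lc CM δM := ⟨_, 1, one_pos, vertexFamily_M1Of hH1 cΛ j⟩
  have hgl : ∃ Cg δg : ℝ, 0 < δg ∧ LocStencil (fun κ u => diagK fun p a => γ j * ctGenM 3 (bhK Lc + Dsh Lc) α Lc κ u p a) Cg δg :=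
    ⟨_, δB / 2, half_pos hδB, locStencil_diagK_mul_ctGenM hBd hδB.le (γ j) α Lc⟩
  have hBl : ∃ C δ : ℝ, 0 < δ ∧ LocStencil₂ (fun (κ : Fin 4) (u : Fin 4 → ℤ) (κ' : Fin 4) (u' : Fin 4 → ℤ) =>
      (0 : ℕ → Fin 4 → Fin 4 → (Fin 4 → ℤ) → Fin 4 → (Fin 4 → ℤ) → MKer 4 (Fib 3)) (j + 1) α κ u κ' u') C δ :=
    ⟨0, 1, one_pos, fun κ u κ' u' x z a b => by simp⟩
  have hbl : ∃ Cb δb : ℝ, 0 < δb ∧ LocStencil₂ (fun κ u κ' u' => diagK fun p c =>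
      (γ (j + 1) * ctGenM 3 (bhK Lc + Dsh Lc) α Lc κ u p c) * (γ (j + 1) * ctGenM 3 (bhK Lc + Dsh Lc) α Lc κ' u' p c)) Cb δb :=
    ⟨_, δB / 3, by positivity, locStencil₂_diagK_ctGenM_mul_ctGenM hBd hδB.le (γ (j + 1)) (γ (j + 1)) α Lc⟩
  exact locStencil₂_R2succ_of_sep hL1 hG h𝕄 hS hM hgl hX hΔ hBl hbl (((Lc : ℝ) ^ 8) * wV4 3 Lc (j + 1)) (wVH 3 Lc (j + 1))

end Literal


/-! ## §4 The class step ON THE OWNER's RECURSIVE REMAINDER `combR2An1` (`CombSecondOrderRemainderAn1`, the (III′) twin of N11 `SymSecondOrderRemainderAn1` p299523) -/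

section Recursive

variable {Lc : ℕ} [NeZero Lc]

/-- [folklore] **THE CLASS OF `combR2An1 … (j+1) α` FROM THE LEVEL-`j` SEPARATION CLASSES OF `X2s j α` AND `combΔAn1 … j α`**: the owner's recursive
remainder (ROOT K's `R2`) at level `j+1` is a `LocStencil₂` family at some positive rate once the free symbol table `X2s j α` (through `diagK`) and the
defined split defect `combΔAn1 … j α` are separation-localised at level `j` (§3 read through `CombSecondOrderRemainderAn1.hR2succ_comb`, which is `rfl`). -/
theorem locStencil₂_combR2An1_succ (N : ℕ) (cΛ : ℝ) (γ : ℕ → ℝ)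
    (X2s : ℕ → Fin 4 → Fin 4 → (Fin 4 → ℤ) → Fin 4 → (Fin 4 → ℤ) → (Fin 4 → ℤ) → Fib 3 → ℝ) (j : ℕ) (α : Fin 4)
    (hX : ∃ C δ : ℝ, 0 < δ ∧ ∀ μ y ν y', BiLoc (diagK (X2s j α μ y ν y')) ((Lc : ℤ) • y) ((Lc : ℤ) • y)
      (C * Real.exp (-δ * l1 ((Lc : ℤ) • y - (Lc : ℤ) • y'))) δ)
    (hΔ : ∃ C δ : ℝ, 0 < δ ∧ ∀ μ y ν y', BiLoc (combΔAn1 Lc N cΛ γ X2s j α μ y ν y') ((Lc : ℤ) • y) ((Lc : ℤ) • y)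
      (C * Real.exp (-δ * l1 ((Lc : ℤ) • y - (Lc : ℤ) • y'))) δ) :
    ∃ C δ : ℝ, 0 < δ ∧ LocStencil₂ (combR2An1 Lc N cΛ γ X2s (j + 1) α) C δ := by
  obtain ⟨C, δ, hδ, h⟩ := locStencil₂_R2succ_symTablesAn1 (Lc := Lc) cΛ γ j α (X2s := X2s) (Δ := combΔAn1 Lc N cΛ γ X2s) hX hΔ
  refine ⟨C, δ, hδ, fun κ u κ' u' => ?_⟩
  rw [hR2succ_comb]
  exact h κ u κ' u'

end Recursive

end Summit.QuantumFields.BalabanUV.Beta.CombSecondOrderClassStep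

end
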